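import Summits.ResolutionOfSingularities.ResolutionOfSingularities.Theorems.FrobeniusLadderFInjectiveMacaulayficationGenericFInjectivizationOfStrongPlusStep
import HarnessLib

/-!
# HOLE #3 FROM CLOSED-LOCUS STEPS — the glue of strategist line `closed-centre` (#3-glue), crux `FInjectiveMacaulayfication`
# (stmt-ResolutionOfSingularities-15315, chain w45a; res-L1-w45a-strat-1's `line-closed-centre.lean` 29dfe362 §#3-glue; lead seat
# res-L1-w45a-lead-1 gen 3)

[OURS · L1 W4.5a] AI-written; AI review is weaker than expert review. NOT a statement of any manuscript; no named fact (the
ring-level openness and the step enter as HYPOTHESES).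

The strategist's re-cut of hole #3 (`stub_closedLocusStrongPlusStep`, #3β) lets the producer of a repair step at a maximal
non-closed bad point `η` modify along ANY closed `Z ∋ η` (not just `closure {η}`), provided the model is an isomorphism off `Z` and
good at every non-closed point over `Z`. This file proves that the ASSEMBLY of hole #3 survives the re-cut (strat-1's stub #3-glue,
typed S/M folklore): `card_maximal_nonclosed_lt_of_closedLocusStep` (the measure still drops: stub-1's comparison map p486389 used
of `U = (closure {η})ᶜ` only openness, `η ∉ U`, and goodness over `Uᶜ`), `genericFInjectivization_of_closedLocusStep_schemeOpen`
(R3″ p486964 / skeleton v14+ `…_schemeOpen` with the `Z`-step), and `stub_genericFInjectivization_of_closedLocusStep` — the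
strategist's #3-glue text VERBATIM (ring-level openness hypothesis, transported by `FiLocusOpenOfAffine.fiLocusOpen_of_ringLevel`
p461884). So adopting line `closed-centre` costs nothing on the hole-#3 side: its open content is exactly #3β.
No definitions, no named facts. [folklore]
-/

set_option linter.dupNamespace false

open AlgebraicGeometry CategoryTheory Literature.AlgebraicGeometry.Resolution
open TopologicalSpace

namespace Summit.ResolutionOfSingularities.ResolutionOfSingularities.Theorems.FInjectiveMacaulayfication.GenericFInjectivizationOfClosedLocusStep

open Summit.ResolutionOfSingularities.ResolutionOfSingularities.Theorems.FInjectiveMacaulayfication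

/-- **MEASURE DESCENT FOR A CLOSED-LOCUS STEP** (the `Z`-version of `BadMaximalPoints.card_maximal_nonclosed_lt_of_strongPlusStep`,
p486389): `π : X₂ ⟶ X₁` an isomorphism over the open `U = Zᶜ`, the bad predicates corresponding over `U`, NO non-closed bad point of
`X₂` over `Z`, and `η ∈ Z` a maximal non-closed bad point of `X₁`: then `X₂` has strictly fewer maximal non-closed bad points than
`X₁` (the comparison map `x ↦ π x` is injective and misses `η`). The original proof verbatim; it used of `U = (closure {η})ᶜ` only
that `U` is open, misses `η`, and that nothing non-closed and bad lies over its complement. [folklore] -/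
theorem card_maximal_nonclosed_lt_of_closedLocusStep {X₂ X₁ : Scheme.{0}} (π : X₂ ⟶ X₁) (η : X₁) (Z : Set X₁) (U : X₁.Opens)
    (hU : (U : Set X₁) = Zᶜ) (hηZ : η ∈ Z) [IsIso (π ∣_ U)] (Bad₁ : X₁ → Prop) (Bad₂ : X₂ → Prop)
    (htrans : ∀ x : X₂, π.base x ∈ U → (Bad₂ x ↔ Bad₁ (π.base x)))
    (hgood : ∀ x : X₂, π.base x ∈ Z → ¬ IsClosed ({x} : Set X₂) → ¬ Bad₂ x)
    (hη : ¬ IsClosed ({η} : Set X₁) ∧ Bad₁ η ∧ ∀ y : X₁, Bad₁ y → y ⤳ η → y = η)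
    (hfin : {ξ : X₁ | Bad₁ ξ ∧ ∀ y : X₁, Bad₁ y → y ⤳ ξ → y = ξ}.Finite) :
    Nat.card {ξ : X₂ // ¬ IsClosed ({ξ} : Set X₂) ∧ Bad₂ ξ ∧ ∀ y : X₂, Bad₂ y → y ⤳ ξ → y = ξ} <
      Nat.card {ξ : X₁ // ¬ IsClosed ({ξ} : Set X₁) ∧ Bad₁ ξ ∧ ∀ y : X₁, Bad₁ y → y ⤳ ξ → y = ξ} := by
  classical
  -- a non-closed bad point of `X₂` lies over `U`
  have hoverU : ∀ x : X₂, ¬ IsClosed ({x} : Set X₂) → Bad₂ x → π.base x ∈ U := fun x hxc hx => by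
    rw [← SetLike.mem_coe, hU, Set.mem_compl_iff]
    exact fun h => hgood x h hxc hx
  -- `U` is stable under generization
  have hgenU : ∀ (y y' : X₁), y ⤳ y' → y' ∈ U → y ∈ U := fun y y' hsp hy' => hsp.mem_open U.2 hy'
  -- the comparison map
  let f : {ξ : X₂ // ¬ IsClosed ({ξ} : Set X₂) ∧ Bad₂ ξ ∧ ∀ y : X₂, Bad₂ y → y ⤳ ξ → y = ξ} →
      {ξ : X₁ // ¬ IsClosed ({ξ} : Set X₁) ∧ Bad₁ ξ ∧ ∀ y : X₁, Bad₁ y → y ⤳ ξ → y = ξ} := fun x =>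
    ⟨π.base x.1,
      fun hc => x.2.1 (BadMaximalPoints.isClosed_singleton_of_isClosed_base π U x.1 (hoverU x.1 x.2.1 x.2.2.1) hc),
      (htrans x.1 (hoverU x.1 x.2.1 x.2.2.1)).mp x.2.2.1, fun y hy hsp => by
      have hxU := hoverU x.1 x.2.1 x.2.2.1
      have hyU : y ∈ U := hgenU y _ hsp hxU
      obtain ⟨x', hx'⟩ := BadMaximalPoints.exists_base_eq_of_isIso_morphismRestrict π U y hyU
      have hx'U : π.base x' ∈ U := hx' ▸ hyU
      have hbad' : Bad₂ x' := (htrans x' hx'U).mpr (hx' ▸ hy)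
      have hsp' : x' ⤳ x.1 :=
        (BadMaximalPoints.specializes_iff_of_isIso_morphismRestrict π U x' x.1 hx'U hxU).mpr (hx' ▸ hsp)
      rw [← hx', x.2.2.2 x' hbad' hsp']⟩
  have hfinj : Function.Injective f := by
    intro x x' h
    have h' : π.base x.1 = π.base x'.1 := congrArg Subtype.val h
    exact Subtype.ext (BadMaximalPoints.eq_of_base_eq_of_isIso_morphismRestrict π U x.1 x'.1 (hoverU x.1 x.2.1 x.2.2.1)
      (hoverU x'.1 x'.2.1 x'.2.2.1) h')
  have hηnot : (⟨η, hη⟩ : {ξ : X₁ // ¬ IsClosed ({ξ} : Set X₁) ∧ Bad₁ ξ ∧ ∀ y : X₁, Bad₁ y → y ⤳ ξ → y = ξ}) ∉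
      Set.range f := by
    rintro ⟨x, hx⟩
    have h' : π.base x.1 = η := congrArg Subtype.val hx
    have hU' := hoverU x.1 x.2.1 x.2.2.1
    rw [h', ← SetLike.mem_coe, hU, Set.mem_compl_iff] at hU'
    exact hU' hηZ
  have hfin' : {ξ : X₁ | ¬ IsClosed ({ξ} : Set X₁) ∧ Bad₁ ξ ∧ ∀ y : X₁, Bad₁ y → y ⤳ ξ → y = ξ}.Finite :=
    hfin.subset fun ξ hξ => hξ.2
  haveI : Finite {ξ : X₁ // ¬ IsClosed ({ξ} : Set X₁) ∧ Bad₁ ξ ∧ ∀ y : X₁, Bad₁ y → y ⤳ ξ → y = ξ} := hfin'.to_subtype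
  haveI : Finite {ξ : X₂ // ¬ IsClosed ({ξ} : Set X₂) ∧ Bad₂ ξ ∧ ∀ y : X₂, Bad₂ y → y ⤳ ξ → y = ξ} :=
    Finite.of_injective f hfinj
  haveI := Fintype.ofFinite {ξ : X₁ // ¬ IsClosed ({ξ} : Set X₁) ∧ Bad₁ ξ ∧ ∀ y : X₁, Bad₁ y → y ⤳ ξ → y = ξ}
  haveI := Fintype.ofFinite {ξ : X₂ // ¬ IsClosed ({ξ} : Set X₂) ∧ Bad₂ ξ ∧ ∀ y : X₂, Bad₂ y → y ⤳ ξ → y = ξ}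
  rw [Nat.card_eq_fintype_card, Nat.card_eq_fintype_card]
  exact Fintype.card_lt_of_injective_of_notMem f hfinj hηnot

/-- **GENERIC F-INJECTIVIZATION FROM CLOSED-LOCUS STEPS (scheme-level openness).** At a fixed prime `p`: if the F-injective
locus of every finite-type everywhere-CM `k`-scheme is open, and every admissible everywhere-CM integral `X₁` admits at each of its
maximal non-closed bad points `η` a closed-locus STRONG⁺ step (iso off a closed `Z ∋ η`, integral CM model, full clause at every
non-closed point over `Z`), then every admissible everywhere-CM integral `X₁` has a proper birational integral everywhere-CM model all
of whose NON-CLOSED points satisfy the Frobenius clause. Proof: well-founded descent on the number of maximal non-closed bad points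
(`MeasureDescent`, `MaximalBadPoint`, `card_maximal_nonclosed_lt_of_closedLocusStep`). [folklore] -/
theorem genericFInjectivization_of_closedLocusStep_schemeOpen (p : ℕ)
    (hFI : ∀ (k : Type) [Field k] [CharP k p] (X₁ : Scheme.{0}) (f₁ : X₁ ⟶ Spec (.of k)), LocallyOfFiniteType f₁ → (∀ x : X₁, ∀ d : ℕ, ringKrullDim (X₁.presheaf.stalk x) = d → ∀ s : Fin d → X₁.presheaf.stalk x, (Ideal.span (Set.range s)).radical.IsMaximal → RingTheory.Sequence.IsWeaklyRegular (X₁.presheaf.stalk x) (List.ofFn s)) → IsOpen {x : X₁ | ∀ d : ℕ, ringKrullDim (X₁.presheaf.stalk x) = d → ∀ s : Fin d → X₁.presheaf.stalk x, (Ideal.span (Set.range s)).radical.IsMaximal → ∀ y : X₁.presheaf.stalk x, (∃ e : ℕ, y ^ p ^ e ∈ Ideal.span ((fun z : X₁.presheaf.stalk x => z ^ p ^ e) '' (Ideal.span (Set.range s) : Set (X₁.presheaf.stalk x)))) → y ∈ Ideal.span (Set.range s)})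
    (step : ∀ (k : Type) [Field k] [CharP k p] (X₁ : Scheme.{0}) (f₁ : X₁ ⟶ Spec (.of k)),
      IsSeparated f₁ → LocallyOfFiniteType f₁ → QuasiCompact f₁ → IsIntegral X₁ →
      (∀ x : X₁, (∀ d : ℕ, ringKrullDim (X₁.presheaf.stalk x) = d → ∀ s : Fin d → X₁.presheaf.stalk x, (Ideal.span (Set.range s)).radical.IsMaximal → RingTheory.Sequence.IsWeaklyRegular (X₁.presheaf.stalk x) (List.ofFn s))) →
      ∀ η : X₁, (¬ IsClosed ({η} : Set X₁) ∧ ¬ (∀ d : ℕ, ringKrullDim (X₁.presheaf.stalk η) = d → ∀ s : Fin d → X₁.presheaf.stalk η, (Ideal.span (Set.range s)).radical.IsMaximal → ∀ t : X₁.presheaf.stalk η, (∃ e : ℕ, t ^ p ^ e ∈ Ideal.span ((fun z : X₁.presheaf.stalk η => z ^ p ^ e) '' (Ideal.span (Set.range s) : Set (X₁.presheaf.stalk η)))) → t ∈ Ideal.span (Set.range s)) ∧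
        ∀ y : X₁, y ⤳ η → y ≠ η → (∀ d : ℕ, ringKrullDim (X₁.presheaf.stalk y) = d → ∀ s : Fin d → X₁.presheaf.stalk y, (Ideal.span (Set.range s)).radical.IsMaximal → ∀ t : X₁.presheaf.stalk y, (∃ e : ℕ, t ^ p ^ e ∈ Ideal.span ((fun z : X₁.presheaf.stalk y => z ^ p ^ e) '' (Ideal.span (Set.range s) : Set (X₁.presheaf.stalk y)))) → t ∈ Ideal.span (Set.range s))) →
        ∃ (X₂ : Scheme.{0}) (π : X₂ ⟶ X₁), IsProper π ∧ Literature.AlgebraicGeometry.Resolution.IsBirational π ∧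
          IsIntegral X₂ ∧ (∀ x : X₂, (∀ d : ℕ, ringKrullDim (X₂.presheaf.stalk x) = d → ∀ s : Fin d → X₂.presheaf.stalk x, (Ideal.span (Set.range s)).radical.IsMaximal → RingTheory.Sequence.IsWeaklyRegular (X₂.presheaf.stalk x) (List.ofFn s))) ∧
          ∃ (Z : Set X₁) (hZ : IsClosed Z), η ∈ Z ∧ IsIso (π ∣_ ⟨Zᶜ, hZ.isOpen_compl⟩) ∧
          ∀ x : X₂, π.base x ∈ Z → ¬ IsClosed ({x} : Set X₂) → (IsDomain (X₂.presheaf.stalk x) ∧ ∀ d : ℕ, ringKrullDim (X₂.presheaf.stalk x) = d → ∀ s : Fin d → X₂.presheaf.stalk x, (Ideal.span (Set.range s)).radical.IsMaximal → RingTheory.Sequence.IsWeaklyRegular (X₂.presheaf.stalk x) (List.ofFn s) ∧ ∀ t : X₂.presheaf.stalk x, (∃ e : ℕ, t ^ p ^ e ∈ Ideal.span ((fun z : X₂.presheaf.stalk x => z ^ p ^ e) '' (Ideal.span (Set.range s) : Set (X₂.presheaf.stalk x)))) → t ∈ Ideal.span (Set.range s))) :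
    ∀ (k : Type) [Field k] [CharP k p] (X₁ : Scheme.{0}) (f₁ : X₁ ⟶ Spec (.of k)), IsSeparated f₁ → LocallyOfFiniteType f₁ → QuasiCompact f₁ → IsIntegral X₁ → (∀ x : X₁, ∀ d : ℕ, ringKrullDim (X₁.presheaf.stalk x) = d → ∀ s : Fin d → X₁.presheaf.stalk x, (Ideal.span (Set.range s)).radical.IsMaximal → RingTheory.Sequence.IsWeaklyRegular (X₁.presheaf.stalk x) (List.ofFn s)) → ∃ (X₂ : Scheme.{0}) (π : X₂ ⟶ X₁), IsProper π ∧ Literature.AlgebraicGeometry.Resolution.IsBirational π ∧ IsIntegral X₂ ∧ (∀ x : X₂, ∀ d : ℕ, ringKrullDim (X₂.presheaf.stalk x) = d → ∀ s : Fin d → X₂.presheaf.stalk x, (Ideal.span (Set.range s)).radical.IsMaximal → RingTheory.Sequence.IsWeaklyRegular (X₂.presheaf.stalk x) (List.ofFn s)) ∧ ∀ x : X₂, ¬ IsClosed ({x} : Set X₂) → ∀ d : ℕ, ringKrullDim (X₂.presheaf.stalk x) = d → ∀ s : Fin d → X₂.presheaf.stalk x, (Ideal.span (Set.range s)).radical.IsMaximal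 → ∀ y : X₂.presheaf.stalk x, (∃ e : ℕ, y ^ p ^ e ∈ Ideal.span ((fun z : X₂.presheaf.stalk x => z ^ p ^ e) '' (Ideal.span (Set.range s) : Set (X₂.presheaf.stalk x)))) → y ∈ Ideal.span (Set.range s) := by
  intro k _ _ X₁ f₁ hsep hft hqc hint hCM
  -- states: admissible pairs over the fixed `k`
  let S : Type 1 := Σ X : Scheme.{0}, {f : X ⟶ Spec (.of k) // IsSeparated f ∧ LocallyOfFiniteType f ∧
    QuasiCompact f ∧ IsIntegral X ∧ ∀ x : X, (∀ d : ℕ, ringKrullDim (X.presheaf.stalk x) = d → ∀ s : Fin d → X.presheaf.stalk x, (Ideal.span (Set.range s)).radical.IsMaximal → RingTheory.Sequence.IsWeaklyRegular (X.presheaf.stalk x) (List.ofFn s))}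
  have key :=
    MeasureDescent.genericFInjectivization_of_stateMeasure p k (S := S) (W := ℕ) (· < ·) wellFounded_lt
      (fun σ => Nat.card {ξ : σ.1 // ¬ IsClosed ({ξ} : Set σ.1) ∧ ¬ (∀ d : ℕ, ringKrullDim (σ.1.presheaf.stalk ξ) = d → ∀ s : Fin d → σ.1.presheaf.stalk ξ, (Ideal.span (Set.range s)).radical.IsMaximal → ∀ t : σ.1.presheaf.stalk ξ, (∃ e : ℕ, t ^ p ^ e ∈ Ideal.span ((fun z : σ.1.presheaf.stalk ξ => z ^ p ^ e) '' (Ideal.span (Set.range s) : Set (σ.1.presheaf.stalk ξ)))) → t ∈ Ideal.span (Set.range s)) ∧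
        ∀ y : σ.1, ¬ (∀ d : ℕ, ringKrullDim (σ.1.presheaf.stalk y) = d → ∀ s : Fin d → σ.1.presheaf.stalk y, (Ideal.span (Set.range s)).radical.IsMaximal → ∀ t : σ.1.presheaf.stalk y, (∃ e : ℕ, t ^ p ^ e ∈ Ideal.span ((fun z : σ.1.presheaf.stalk y => z ^ p ^ e) '' (Ideal.span (Set.range s) : Set (σ.1.presheaf.stalk y)))) → t ∈ Ideal.span (Set.range s)) → y ⤳ ξ → y = ξ})
      (fun σ => σ.1) (fun σ => ⟨σ.2.2.2.2.2.1, σ.2.2.2.2.2.2⟩) ?_ ⟨X₁, f₁, hsep, hft, hqc, hint, hCM⟩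
  · obtain ⟨X₂, π, hπ, hbir, hint₂, hCM₂, hgood⟩ := key
    exact ⟨X₂, π, hπ, hbir, hint₂, hCM₂, hgood⟩
  -- the step on states
  rintro ⟨X, f, hsepX, hftX, hqcX, hintX, hCMX⟩ hbad
  haveI := hftX
  haveI := hqcX
  -- a maximal non-closed bad point
  obtain ⟨η, hηnc, hηbad, hηmax⟩ := MaximalBadPoint.exists_maximal_not_of_exists_not_isClosed f
    (fun x : X => (∀ d : ℕ, ringKrullDim (X.presheaf.stalk x) = d → ∀ s : Fin d → X.presheaf.stalk x, (Ideal.span (Set.range s)).radical.IsMaximal → ∀ t : X.presheaf.stalk x, (∃ e : ℕ, t ^ p ^ e ∈ Ideal.span ((fun z : X.presheaf.stalk x => z ^ p ^ e) '' (Ideal.span (Set.range s) : Set (X.presheaf.stalk x)))) → t ∈ Ideal.span (Set.range s))) hbad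
  obtain ⟨X', π, hπ, hbir, hint', hCM', Z, hZ, hηZ, hiso, hgood⟩ :=
    step k X f hsepX hftX hqcX hintX hCMX η ⟨hηnc, hηbad, hηmax⟩
  haveI := hπ
  have hsep' : IsSeparated (π ≫ f) := inferInstance
  have hft' : LocallyOfFiniteType (π ≫ f) := inferInstance
  have hqc' : QuasiCompact (π ≫ f) := inferInstance
  refine ⟨⟨X', π ≫ f, hsep', hft', hqc', hint', hCM'⟩, π, hπ, hbir, ?_⟩
  -- the bad locus of `X` is closed (Datta–Murayama, ring level → scheme level)
  have hopen := hFI k X f hftX hCMX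
  have hclosed : IsClosed {x : X | ¬ (∀ d : ℕ, ringKrullDim (X.presheaf.stalk x) = d → ∀ s : Fin d → X.presheaf.stalk x, (Ideal.span (Set.range s)).radical.IsMaximal → ∀ t : X.presheaf.stalk x, (∃ e : ℕ, t ^ p ^ e ∈ Ideal.span ((fun z : X.presheaf.stalk x => z ^ p ^ e) '' (Ideal.span (Set.range s) : Set (X.presheaf.stalk x)))) → t ∈ Ideal.span (Set.range s))} := by
    rw [← isOpen_compl_iff]
    convert hopen using 1
    ext x
    simp only [Set.mem_compl_iff, Set.mem_setOf_eq, not_not]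
  haveI : IsLocallyNoetherian X := LocallyOfFiniteType.isLocallyNoetherian f
  haveI : CompactSpace X := QuasiCompact.compactSpace_of_compactSpace f
  haveI : IsNoetherian X := {}
  have hfin := BadMaximalPoints.finite_setOf_maximal_of_isClosed hclosed
  haveI := hiso
  refine card_maximal_nonclosed_lt_of_closedLocusStep π η Z ⟨Zᶜ, hZ.isOpen_compl⟩ rfl hηZ
    (fun y : X => ¬ (∀ d : ℕ, ringKrullDim (X.presheaf.stalk y) = d → ∀ s : Fin d → X.presheaf.stalk y, (Ideal.span (Set.range s)).radical.IsMaximal → ∀ t : X.presheaf.stalk y, (∃ e : ℕ, t ^ p ^ e ∈ Ideal.span ((fun z : X.presheaf.stalk y => z ^ p ^ e) '' (Ideal.span (Set.range s) : Set (X.presheaf.stalk y)))) → t ∈ Ideal.span (Set.range s)))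
    (fun x : X' => ¬ (∀ d : ℕ, ringKrullDim (X'.presheaf.stalk x) = d → ∀ s : Fin d → X'.presheaf.stalk x, (Ideal.span (Set.range s)).radical.IsMaximal → ∀ t : X'.presheaf.stalk x, (∃ e : ℕ, t ^ p ^ e ∈ Ideal.span ((fun z : X'.presheaf.stalk x => z ^ p ^ e) '' (Ideal.span (Set.range s) : Set (X'.presheaf.stalk x)))) → t ∈ Ideal.span (Set.range s)))
    (fun x hx => not_congr (IsoLocusTransport.fClause_iff_of_isIso_morphismRestrict p π _ x hx).symm)
    (fun x hx hxc hb => hb fun d hd s hs => ((hgood x hx hxc).2 d hd s hs).2) ⟨hηnc, hηbad, fun y hy hsp => ?_⟩ ?_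
  · by_contra hne
    exact hy (hηmax y hsp hne)
  · simpa only [Set.mem_setOf_eq] using hfin

/-- **Strategist stub #3-glue, VERBATIM** (`line-closed-centre.lean` 29dfe362, `stub_genericFInjectivization_of_closedLocusStep`):
the same with the RING-LEVEL openness hypothesis (Datta–Murayama's shape at `u = 0`, fixed `p`), transported to schemes by
`FiLocusOpenOfAffine.fiLocusOpen_of_ringLevel` (p461884). [folklore] -/
theorem stub_genericFInjectivization_of_closedLocusStep : ∀ (p : ℕ), p.Prime →
    (∀ (k : Type) [Field k] [CharP k p] (R : Type) [CommRing R] [Algebra k R],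
    Algebra.FiniteType k R →
    (∀ (P : Ideal R) [P.IsPrime], ∀ d : ℕ, ringKrullDim (Localization.AtPrime P) = d →
      ∀ s : Fin d → Localization.AtPrime P, (Ideal.span (Set.range s)).radical.IsMaximal →
        RingTheory.Sequence.IsWeaklyRegular (Localization.AtPrime P) (List.ofFn s)) →
    IsOpen {P : PrimeSpectrum R | ∀ d : ℕ, ringKrullDim (Localization.AtPrime P.asIdeal) = d →
      ∀ s : Fin d → Localization.AtPrime P.asIdeal, (Ideal.span (Set.range s)).radical.IsMaximal →
        ∀ y : Localization.AtPrime P.asIdeal, (∃ e : ℕ, y ^ p ^ e ∈ Ideal.span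
          ((fun z : Localization.AtPrime P.asIdeal => z ^ p ^ e) ''
            (Ideal.span (Set.range s) : Set (Localization.AtPrime P.asIdeal)))) →
          y ∈ Ideal.span (Set.range s)}) →
    (∀ (k : Type) [Field k] [CharP k p] (X₁ : Scheme.{0}) (f₁ : X₁ ⟶ Spec (.of k)),
      IsSeparated f₁ → LocallyOfFiniteType f₁ → QuasiCompact f₁ → IsIntegral X₁ →
      (∀ x : X₁, (∀ d : ℕ, ringKrullDim (X₁.presheaf.stalk x) = d → ∀ s : Fin d → X₁.presheaf.stalk x, (Ideal.span (Set.range s)).radical.IsMaximal → RingTheory.Sequence.IsWeaklyRegular (X₁.presheaf.stalk x) (List.ofFn s))) →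
      ∀ η : X₁, (¬ IsClosed ({η} : Set X₁) ∧ ¬ (∀ d : ℕ, ringKrullDim (X₁.presheaf.stalk η) = d → ∀ s : Fin d → X₁.presheaf.stalk η, (Ideal.span (Set.range s)).radical.IsMaximal → ∀ t : X₁.presheaf.stalk η, (∃ e : ℕ, t ^ p ^ e ∈ Ideal.span ((fun z : X₁.presheaf.stalk η => z ^ p ^ e) '' (Ideal.span (Set.range s) : Set (X₁.presheaf.stalk η)))) → t ∈ Ideal.span (Set.range s)) ∧
        ∀ y : X₁, y ⤳ η → y ≠ η → (∀ d : ℕ, ringKrullDim (X₁.presheaf.stalk y) = d → ∀ s : Fin d → X₁.presheaf.stalk y, (Ideal.span (Set.range s)).radical.IsMaximal → ∀ t : X₁.presheaf.stalk y, (∃ e : ℕ, t ^ p ^ e ∈ Ideal.span ((fun z : X₁.presheaf.stalk y => z ^ p ^ e) '' (Ideal.span (Set.range s) : Set (X₁.presheaf.stalk y)))) → t ∈ Ideal.span (Set.range s))) →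
        ∃ (X₂ : Scheme.{0}) (π : X₂ ⟶ X₁), IsProper π ∧ Literature.AlgebraicGeometry.Resolution.IsBirational π ∧
          IsIntegral X₂ ∧ (∀ x : X₂, (∀ d : ℕ, ringKrullDim (X₂.presheaf.stalk x) = d → ∀ s : Fin d → X₂.presheaf.stalk x, (Ideal.span (Set.range s)).radical.IsMaximal → RingTheory.Sequence.IsWeaklyRegular (X₂.presheaf.stalk x) (List.ofFn s))) ∧
          ∃ (Z : Set X₁) (hZ : IsClosed Z), η ∈ Z ∧ IsIso (π ∣_ ⟨Zᶜ, hZ.isOpen_compl⟩) ∧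
          ∀ x : X₂, π.base x ∈ Z → ¬ IsClosed ({x} : Set X₂) → (IsDomain (X₂.presheaf.stalk x) ∧ ∀ d : ℕ, ringKrullDim (X₂.presheaf.stalk x) = d → ∀ s : Fin d → X₂.presheaf.stalk x, (Ideal.span (Set.range s)).radical.IsMaximal → RingTheory.Sequence.IsWeaklyRegular (X₂.presheaf.stalk x) (List.ofFn s) ∧ ∀ t : X₂.presheaf.stalk x, (∃ e : ℕ, t ^ p ^ e ∈ Ideal.span ((fun z : X₂.presheaf.stalk x => z ^ p ^ e) '' (Ideal.span (Set.range s) : Set (X₂.presheaf.stalk x)))) → t ∈ Ideal.span (Set.range s))) →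
    ∀ (k : Type) [Field k] [CharP k p] (X₁ : Scheme.{0}) (f₁ : X₁ ⟶ Spec (.of k)),
        IsSeparated f₁ → LocallyOfFiniteType f₁ → QuasiCompact f₁ → IsIntegral X₁ →
        (∀ x : X₁, ∀ d : ℕ, ringKrullDim (X₁.presheaf.stalk x) = d → ∀ s : Fin d → X₁.presheaf.stalk x, (Ideal.span (Set.range s)).radical.IsMaximal → RingTheory.Sequence.IsWeaklyRegular (X₁.presheaf.stalk x) (List.ofFn s)) →
        ∃ (X₂ : Scheme.{0}) (π : X₂ ⟶ X₁), IsProper π ∧ Literature.AlgebraicGeometry.Resolution.IsBirational π ∧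
          IsIntegral X₂ ∧ (∀ x : X₂, ∀ d : ℕ, ringKrullDim (X₂.presheaf.stalk x) = d → ∀ s : Fin d → X₂.presheaf.stalk x, (Ideal.span (Set.range s)).radical.IsMaximal → RingTheory.Sequence.IsWeaklyRegular (X₂.presheaf.stalk x) (List.ofFn s)) ∧
          ∀ x : X₂, ¬ IsClosed ({x} : Set X₂) → ∀ d : ℕ, ringKrullDim (X₂.presheaf.stalk x) = d → ∀ s : Fin d → X₂.presheaf.stalk x, (Ideal.span (Set.range s)).radical.IsMaximal → ∀ y : X₂.presheaf.stalk x, (∃ e : ℕ, y ^ p ^ e ∈ Ideal.span ((fun z : X₂.presheaf.stalk x => z ^ p ^ e) '' (Ideal.span (Set.range s) : Set (X₂.presheaf.stalk x)))) → y ∈ Ideal.span (Set.range s) := by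
  intro p _ hDM step k _ _ X₁ f₁ hsep hft hqc hint hCM
  exact genericFInjectivization_of_closedLocusStep_schemeOpen p
    (fun k' _ _ X f hftX hCMX =>
      FiLocusOpenOfAffine.fiLocusOpen_of_ringLevel p k' (fun R _ _ hR hRCM => hDM k' R hR hRCM) X f hftX hCMX)
    step k X₁ f₁ hsep hft hqc hint hCM

end Summit.ResolutionOfSingularities.ResolutionOfSingularities.Theorems.FInjectiveMacaulayfication.GenericFInjectivizationOfClosedLocusStep
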